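import Summits.CriticalPhenomena.PercolationContinuityZ3.Theorems.PercNearOneGluingNoHeavyLowerTailSahiCombTriWAntiNestedKernelProof

/-!
# `TRI_W(2) ≥ 0` whenever the two MIDDLE fibres are comparable in both families (co-nested ∪ anti-nested, one statement)

Support file of the one-cut programme (crux `NoHeavyLowerTail`, stmt-CriticalPhenomena-4575; TRI lane of cell `prim-masterthm`; seat prim-lf-1 gen 38,
memo `FROM-prim-lf-1-gen38-AN3-KERNEL.md` §1).  For a two-atom index cube `univ = {a, b}` a monotone family `F` has fibres
`F ∅ ⊆ F {a}, F {b} ⊆ F univ`; the open target `FiveUpSet.TriWIneq` at `a = 2` is `0 ≤ triW P F G` for all such `F, G` and up-sets `P`.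
This file records the union of the two proved strata as ONE citeable statement:

* `FiveUpSet.pairwise_nested_of_comparable` — bookkeeping: on a two-atom index cube, `F {a} ⊆ F {b} ∧ G {a} ⊆ G {b}` (or the reverse pair) gives the
  hypothesis of `triW_nonneg_of_pairwise_nested` at every index `x`;
* **`FiveUpSet.triW_nonneg_of_comparable_middles`** — if `F {a} ⊆ F {b} ∨ F {b} ⊆ F {a}` and `G {a} ⊆ G {b} ∨ G {b} ⊆ G {a}`, then `0 ≤ triW P F G`:
  the CO-NESTED orientations are `triW_nonneg_of_pairwise_nested` (P5 gen 10, five-up-set theorem), the ANTI-NESTED orientations are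
  `triW_nonneg_of_antiNested_stratum` (prim-lf-1 gen 38, AN♯3) and its mirror under `a ↔ b`.
So at `a = 2` exactly the configurations with an INCOMPARABLE middle pair in at least one family remain open (`ChainTwoIneq`).
HONEST LABEL: a corollary assembling proved strata; no new inequality. [this work]
-/

namespace Summit.CriticalPhenomena.PercolationContinuityZ3.Theorems

namespace FiveUpSet

open Finset

variable {γ : Type} [DecidableEq γ] [Fintype γ] {β : Type} [DecidableEq β] [Fintype β]

omit [DecidableEq γ] [Fintype γ] in
/-- On a two-atom index cube `univ = {a,b}`: every index `x` is `∅`, `{a}`, `{b}` or `univ`, so a pair of monotone families whose middle fibres are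
nested in the SAME direction is pairwise nested along every antipodal pair `{x, xᶜ}` (the hypothesis of `triW_nonneg_of_pairwise_nested`). [this work] -/
theorem pairwise_nested_of_comparable {a b : β} (hab : a ≠ b) (hu : (univ : Finset β) = {a, b}) {δ : Type} (F G : Finset β → Finset δ)
    (hFm : Monotone F) (hGm : Monotone G) (h : (F {a} ⊆ F {b} ∧ G {a} ⊆ G {b}) ∨ (F {b} ⊆ F {a} ∧ G {b} ⊆ G {a})) :
    ∀ x : Finset β, (F x ⊆ F xᶜ ∧ G x ⊆ G xᶜ) ∨ (F xᶜ ⊆ F x ∧ G xᶜ ⊆ G x) := by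
  have cab : ({a} : Finset β)ᶜ = {b} := compl_singleton_eq_of_univ hab hu
  have cba : ({b} : Finset β)ᶜ = {a} := by
    have hu' : (univ : Finset β) = {b, a} := by rw [hu, pair_comm]
    exact compl_singleton_eq_of_univ hab.symm hu'
  intro x
  by_cases ha : a ∈ x
  · by_cases hb : b ∈ x
    · -- `x = univ`
      have hx : x = univ := by
        refine eq_univ_of_forall fun y => ?_
        have hy : y ∈ (univ : Finset β) := mem_univ y
        rw [hu, mem_insert, mem_singleton] at hy
        rcases hy with rfl | rfl
        · exact ha
        · exact hb
      subst hx
      right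
      rw [compl_univ]
      exact ⟨hFm (empty_subset _), hGm (empty_subset _)⟩
    · -- `x = {a}`
      have hx : x = {a} := by
        ext y
        rw [mem_singleton]
        constructor
        · intro hy
          have hy' : y ∈ (univ : Finset β) := mem_univ y
          rw [hu, mem_insert, mem_singleton] at hy'
          rcases hy' with rfl | rfl
          · rfl
          · exact absurd hy hb
        · rintro rfl; exact ha
      subst hx
      rw [cab]
      rcases h with ⟨hF, hG⟩ | ⟨hF, hG⟩
      · exact Or.inl ⟨hF, hG⟩
      · exact Or.inr ⟨hF, hG⟩
  · by_cases hb : b ∈ x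
    · -- `x = {b}`
      have hx : x = {b} := by
        ext y
        rw [mem_singleton]
        constructor
        · intro hy
          have hy' : y ∈ (univ : Finset β) := mem_univ y
          rw [hu, mem_insert, mem_singleton] at hy'
          rcases hy' with rfl | rfl
          · exact absurd hy ha
          · rfl
        · rintro rfl; exact hb
      subst hx
      rw [cba]
      rcases h with ⟨hF, hG⟩ | ⟨hF, hG⟩
      · exact Or.inr ⟨hF, hG⟩
      · exact Or.inl ⟨hF, hG⟩
    · -- `x = ∅`
      have hx : x = ∅ := by
        refine eq_empty_of_forall_notMem fun y hy => ?_
        have hy' : y ∈ (univ : Finset β) := mem_univ y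
        rw [hu, mem_insert, mem_singleton] at hy'
        rcases hy' with rfl | rfl
        · exact ha hy
        · exact hb hy
      subst hx
      left
      rw [compl_empty]
      exact ⟨hFm (empty_subset _), hGm (empty_subset _)⟩

/-- **`TRI_W(2) ≥ 0` for COMPARABLE MIDDLE FIBRES.**  For every finite cube, every up-set `P` and monotone families `F, G` of up-sets over a two-atom
index cube `univ = {a, b}`: if `F {a}` and `F {b}` are comparable and `G {a}` and `G {b}` are comparable (in either direction, independently), then
`0 ≤ triW P F G`.  Same direction = co-nested (`triW_nonneg_of_pairwise_nested`); opposite directions = anti-nested (`triW_nonneg_of_antiNested_stratum`,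
AN♯3, and its `a ↔ b` mirror). [this work] -/
theorem triW_nonneg_of_comparable_middles {a b : β} (hab : a ≠ b) (hu : (univ : Finset β) = {a, b})
    (P : Finset (Finset γ)) (F G : Finset β → Finset (Finset γ))
    (hP : IsUpperSet (P : Set (Finset γ))) (hF : ∀ x, IsUpperSet (F x : Set (Finset γ))) (hG : ∀ x, IsUpperSet (G x : Set (Finset γ)))
    (hFm : Monotone F) (hGm : Monotone G) (hFc : F {a} ⊆ F {b} ∨ F {b} ⊆ F {a}) (hGc : G {a} ⊆ G {b} ∨ G {b} ⊆ G {a}) :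
    0 ≤ triW P F G := by
  rcases hFc with hF₁ | hF₂ <;> rcases hGc with hG₁ | hG₂
  · exact triW_nonneg_of_pairwise_nested P F G hP hF hG (pairwise_nested_of_comparable hab hu F G hFm hGm (Or.inl ⟨hF₁, hG₁⟩))
  · have hu' : (univ : Finset β) = {b, a} := by rw [hu, pair_comm]
    exact triW_nonneg_of_antiNested_stratum hab.symm hu' P F G hP hF hG hFm hGm hF₁ hG₂
  · exact triW_nonneg_of_antiNested_stratum hab hu P F G hP hF hG hFm hGm hF₂ hG₁
  · exact triW_nonneg_of_pairwise_nested P F G hP hF hG (pairwise_nested_of_comparable hab hu F G hFm hGm (Or.inr ⟨hF₂, hG₂⟩))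

end FiveUpSet

end Summit.CriticalPhenomena.PercolationContinuityZ3.Theorems
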